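import Summits.CriticalPhenomena.PercolationContinuityZ3.Theses.PercNearOneGluing
import Literature.Probability.Percolation.PercolationEvents
import HarnessLib.Audit
import Summits.CriticalPhenomena.PercolationContinuityZ3.Theorems.PercNearOneGluingNearOneGluingVariants2415

/-! TTRL-lite variant V2432 of stmt-CriticalPhenomena-4574

(`stub_shorteningStep` of line `kn_shortening_induction`, move `specialise+small_case`:
`n := 3` and `A.card ≤ 4`).  On `Fin 3` the hypothesis `v ∉ A` already forces `A.card ≤ 2`
(`insert v A` has at most `Fintype.card (Fin 3) = 3` elements), so the claim is the already-landed
two-relay case V2415 (`stub_shorteningStep_var2415`, `A.card ≤ 2`, any `n`) specialised to `n = 3`;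
the hypothesis `A.card ≤ 4` is discarded.  (Mathematically, V2415 is Kozma–Nitzan's shortening
step, Conjecture 6 of arXiv:2401.12397 measured against the minimiser `a₀` of the uncontracted
graph, for at most two relays; see the docstring of V2415.)  No new definitions, no named facts,
the induction hypothesis is only passed on. -/

namespace Summit.CriticalPhenomena.PercolationContinuityZ3.Theorems

open MeasureTheory Set Literature.Probability.LatticeModels Literature.Probability.Percolation
open scoped Classical BigOperators

/-- TTRL-lite variant V2432 of `stub_shorteningStep` (stmt-CriticalPhenomena-4574, Kozma–Nitzan
shortening step, arXiv:2401.12397 Conjecture 6, against the old minimiser `a₀`): the inequality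
`μ₁(⋃ a ∈ A, v ↔ a) · μ₁(a₀ ↔ b) ≤ μ₁(v ↔ b)` for the glued measure
`μ₁ = prodBernoulli (w[s(v,x) ↦ 1])` on `Fin 3` with `A.card ≤ 4`.  Since `v ∉ A ⊆ Fin 3` gives
`A.card ≤ 2`, this is the two-relay case `stub_shorteningStep_var2415` at `n = 3`. -/
theorem stub_shorteningStep_var2432 : ∀ (w : Sym2 (Fin 3) → unitInterval) (A : Finset (Fin 3)) (b v x a₀ : Fin 3), A.card ≤ 4 → v ∉ A → v ≠ x → w s(v, x) = 0 → a₀ ∈ A → (∀ a ∈ A, (prodBernoulli w).real (openConn a₀ b) ≤ (prodBernoulli w).real (openConn a b)) → (∀ w' : Sym2 (Fin 3) → unitInterval, (∀ e, w e = 0 → w' e = 0) → ∀ (A' : Finset (Fin 3)) (o' b' : Fin 3) (t : ℝ), (∀ a ∈ A', t ≤ (prodBernoulli w').real (openConn a b')) → (prodBernoulli w').real (⋃ a ∈ A', openConn o' a) * t ≤ (prodBernoulli w').real (openConn o' b')) → (prodBernoulli (Function.update w s(v, x) 1)).real (⋃ a ∈ A, openConn v a) * (prodBernoulli (Function.update w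 s(v, x) 1)).real (openConn a₀ b) ≤ (prodBernoulli (Function.update w s(v, x) 1)).real (openConn v b) := by
  intro w A b v x a₀ _hcard hvA
  -- `v ∉ A ⊆ Fin 3` forces `A.card ≤ 2`
  have hcard2 : A.card ≤ 2 := by
    have h1 : (insert v A).card ≤ Fintype.card (Fin 3) := Finset.card_le_univ _
    rw [Finset.card_insert_of_notMem hvA, Fintype.card_fin] at h1
    omega
  exact stub_shorteningStep_var2415 3 w A b v x a₀ hcard2 hvA

end Summit.CriticalPhenomena.PercolationContinuityZ3.Theorems
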